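import Literature.MathematicalPhysics.QuantumFieldTheory.Balaban1983to89.B1Eq324BenfattoClassSectEMemberAtLetters

/-!
# `Balaban1983to89.B1Eq324BenfattoClassSectEMemberCoReadProduct` — FUNCTORIALITY OF THE COORDINATE MATRIX OVER A FULL ORTHONORMAL BASIS
# (`𝕄_Λ̃(C*·Δ·C) = Eᵀ·𝕄(Δ)·E`), and [Balaban1982Higgs1] (3.24) for `dμ_{C̃^{(k)}(Λ; U)}` AT NODE 00's NAMED LETTERS IN THE PRECISION CURRENCY of
# [Balaban1985BackgroundPropagators] (3.156)–(3.157): the rows of `(QG₁Q*)⁻¹(U)`, of `a + ⟨D̃⁽²⁾·, J⟩`, the locality of `C` and the lower bound `γ₀`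
# DISPLAYED at those letters (seat dag-n08-b gen 32, CLAIM-7; node N08 [Balaban1985UV3], row `h324c`)

statement-level companion of published sources with citation tags; every declaration here is a theorem; nothing here is a claim about the
Yang–Mills mass gap

THE PRINTED LOCUS.  [Balaban1985BackgroundPropagators] (= [B9]) Sect. E p. 428: *"The quadratic form in the above integral can be written also as
⟨B, (QG₁Q*)⁻¹B⟩ − a⟨B, B⟩ − 2⟨H₁D̃⁽²⁾(B), J⟩ = ⟨B, Δ_kB⟩. (3.156) … Variables B depend linearly on B̃ and we have B = CB̃ … e^{½⟨C*g,(C*Δ_kC)⁻¹C*g⟩} (3.157)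
… Localizing the operators in Δ_k and using the methods of Sect. B we can prove it [the lower bound γ₀] for C*Δ_kC with an arbitrary configuration U …
a uniform exponential decay of C*Δ_kC"*; (3.132) p. 422: *"|(QGQ*)⁻¹(y, y′)| ≤ O(1)…e^{−δ₁d(y,y′)} … and the same for the operator with G₁"*.
[Balaban1984PropagatorsII] p. 250: *"C is a short-ranged operator, so C*Δ_kC has the same exponential decay as Δ_k"*.  [Balaban1985UV3] (= [B10])
pp. 271–272: *"the Gaussian integral determined by the positive quadratic form ⟨A, C*Δ_kCA⟩"*; (24) p. 262 cites [Balaban1982Higgs1] (3.24) (row `h324c`).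

WHY THIS MODULE (cell `pub-ymgap`, seat `dag-n08-b` gen 32, CLAIM-7; seat n08-d g26's INTERFACE NOTE «your 𝕄-rows ∘ my presentation» for the precision door).
p667558 (`…ClassSectEMemberAtLetters`) delivered (3.24) for `𝒩(0, 𝕄(C*Δ_kC)⁻¹)` at NODE 00's letters in the COVARIANCE currency — the decay row being
ROW 24's (3.187) for `C^{(k)}(Λ)`.  Print's own route (p. 428, [PropII] p. 250) is the PRECISION currency: the decay of `(QG₁Q*)⁻¹` ((3.132), a numbered row
of node N06's table) and of the `J`-term, the short range of `C`, and the lower bound `γ₀`, give the rows of `C*Δ_kC` directly; this seat's p645440 typed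
that route for a real matrix `Eᵀ(P − a·1 − 𝒥)E` and seat n08-d's p664951 `eq324_sectEPrecision_node00_on_unit` presented its indices at NODE 00.  THIS FILE
supplies the missing algebra — over a full orthonormal BASIS `b` of the fibre the coordinate matrix of p665451 is FUNCTORIAL: `𝕄_Λ̃(C*·Δ·C) = Eᵀ·𝕄(Δ)·E`
with `E` the (index-bond × basis) × (`Λ̃` × basis) coordinate matrix of `C` and `Eᵀ` that of `C*` (β-adjointness) — and fires the precision door AT
THE LETTERS `deltaKY = (QG₁Q*)⁻¹ − a − ⟨D̃⁽²⁾·,J⟩`, `elimCΛY`, `elimCtΛY`, `CsDeltaCY`.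

WHAT IS PROVED (standard axioms; no `sorry`; no definition).
* §1 (generic carrier `X`, fibre `𝔸` with a real BASIS `b` orthonormal for a symmetric pairing `β`: `repr_c v = β(b_c, v)`): `orth_of_repr` · ★
  `pairing_eq_sum_coord` (Parseval: `β(v,w) = Σ_c β(b_c,v)β(b_c,w)`) · ★ `eq_assemble_coord` (every `Φ : X → 𝔸` IS frame-assembled over the full carrier) ·
  ★ `coord_apply_eq_sum_coordMatrix` (`β(b_c,(DΦ)(x)) = Σ_v 𝕄(D)(x,c;v)·β(b_{v.2},Φ(v.1))`) · ★★ `coordMatrix_comp` (`𝕄(A∘B) = 𝕄(A)𝕄(B)`) · `coordMatrix_id` ·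
  ★★★ `coordMatrix_sandwich` (for `C`, `C*` β-adjoint over the carrier
  and any sub-carrier `ι`: `𝕄_ι(C* ∘ D ∘ C) = Eᵀ·𝕄(D)·E`) · `coordMatrix_sub` (`𝕄(P − J) = 𝕄(P) − 0·1 − 𝕄(J)`, the door's shape).
* §2 at def-Y's letters (member `x`, `𝔏 : CovLettersY`, `𝔢 : SectELettersY`, background `U`): `restrictScalars_CsDeltaCY_eq_comp` ((3.157) as a composite of
  ℝ-linear maps) · ★★ `coordMatrix_CsDeltaCY_eq_sandwich` (`𝕄_ι(C*Δ_kC) = Eᵀ·(P − 0·1 − 𝒥)·E` with `P := 𝕄((QG₁Q*)⁻¹(U))`, `𝒥 := 𝕄(a + ⟨D̃⁽²⁾·,J⟩(U))`,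
  `E := 𝕄(P_Λ C P_Λ̃)` — β-adjointness of `elimCΛY ∕ elimCtΛY` displayed) · `locality_coord_of_op` ∕ `colMass_coord_of_op` (the door's `E`-rows from
  operator-currency locality and column mass of `C`).
* §3 ★★★ `eq324_CsDeltaCY_precision_node00_on_unit` — p664951 `eq324_sectEPrecision_node00_on_unit` AT THE LETTERS: class scalars and frame constants FIRST,
  then for EVERY `η ∈ (0,1]`, member, letters, background, pairing `β` with an orthonormal BASIS `b`, injective `ι : σ → Λ̃`, GIVEN AT THE LETTERS (R1′)
  β-self-adjointness of `(QG₁Q*)⁻¹(U)` and of `a + ⟨D̃⁽²⁾·,J⟩(U)` (Thm 3.11 «symmetric»), (R2′) the (3.132) unit-ball kernel reading of `(QG₁Q*)⁻¹(U)` on ALL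
  index bonds in def-Y's `siteKernelOfOp` shape (node N06's ROW for `QG1Qinv`) and a homogeneous kernel reading of `a + ⟨D̃⁽²⁾·,J⟩(U)`, (R3′) `C`, `C*`
  β-adjoint over the carrier, (R4′) locality `(C(δ_{ι s} ⊗ w))(u) ≠ 0 ⇒ |y_u − y_{ι s}| ≤ r` and column mass `Σ_u ‖(C(δ_{ι s} ⊗ b_c))(u)‖ ≤ m` of `P_Λ C P_Λ̃`,
  (R5′) `γ₀·Σβ(Φ,Φ) ≤ Σβ(Φ, C*Δ_kC Φ)` on `ι(σ)`-supported `Φ` (G-B9-09): the conclusion of the precision door for the Gaussian `𝒩(0, 𝕄_ι(C*Δ_kC)⁻¹)` — a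
  window `Λ_w ⊂ ℤ^{2(d+1)+1}`, `e′ : σ × κ ≃ ↥Λ_w` presenting it, the a.e. box identity, the (3.24) pair; one `example` (scalar side elaborates).
HONEST SCOPE.  Count-neutral finite-dimensional linear algebra + one composition BY NAME; (R1′)–(R5′) are node N06's [B9] content ((3.132), Thm 3.11, Sect. E
p. 428 ∕ G-B9-09) and NODE 00's letter geometry, DISPLAYED not proved; no letter constructed or pinned; the IDENT (NODE 00's `(𝔖 k).μ = 𝒩(0, 𝕄_Λ̃(C*Δ_kC)⁻¹).map Φ`,
box, class-II Hamiltonian letters, window `b₁ < b₀`) NOT made, NOT commissioned, NOT claimed; nothing of [Balaban1985UV3], [Balaban1985BackgroundPropagators],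
[Balaban1984PropagatorsII], [Balaban1982Higgs1] or [BenfattoEtAl1978] asserted or discharged; node N08 NOT discharged; nothing about d = 4, the continuum, OS
axioms, a mass gap or the Clay problem.
-/

noncomputable section

open MeasureTheory Finset Matrix

namespace Literature.MathematicalPhysics.QuantumFieldTheory.Balaban1983to89.B1Eq324BenfattoClassSectEMemberCoReadProduct

open Literature.MathematicalPhysics.QuantumFieldTheory
open Literature.MathematicalPhysics.QuantumFieldTheory.Balaban1983to89.B1Eq324BenfattoLemma
open Literature.MathematicalPhysics.QuantumFieldTheory.Balaban1983to89.B6Ineq2142KLevelV1 (lvl)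
open Literature.MathematicalPhysics.QuantumFieldTheory.Balaban1983to89.B9PinMembersKLevelV1 (MemberY)
open Literature.MathematicalPhysics.QuantumFieldTheory.Balaban1983to89.B9PinGeometryKLevelV1 (unitDistY inΛY inΛY_top)
open Literature.MathematicalPhysics.QuantumFieldTheory.Balaban1983to89.Node00
  (IBondY CfgY BallY deltaY secY secCornerY CovLettersY SectELettersY CsDeltaCY deltaKY elimCΛY elimCtΛY aY deltaKY_apply)
open Literature.MathematicalPhysics.QuantumFieldTheory.Balaban1983to89.B1Eq324BenfattoClassSectEMemberCoRead
  (sum_pairing_single coord_single mulVec_coordMatrix coordMatrix_symm_of_selfAdjoint coercive_coordMatrix kernelReading_homog_of_ball abs_coordMatrix_le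
    norm_le_of_iSup_closedBall_le deltaY_eq_single)
open Literature.MathematicalPhysics.QuantumFieldTheory.Balaban1983to89.B1Eq324BenfattoClassSectEMemberAtNode00 (eq324_sectEPrecision_node00_on_unit)

/-! ## §1  Functoriality of the coordinate matrix over a full orthonormal basis -/

section Basis

variable {X : Type*} [Fintype X] [DecidableEq X]
variable {𝔸 : Type*} [AddCommGroup 𝔸] [Module ℝ 𝔸]
variable {κ : Type*} [Fintype κ] [DecidableEq κ]
variable (β : 𝔸 →ₗ[ℝ] 𝔸 →ₗ[ℝ] ℝ) (b : Module.Basis κ ℝ 𝔸)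

omit [Fintype κ] in
/-- an orthonormal basis in seat n06-d's sense (`repr_c v = β(b_c, v)`) is an orthonormal frame in p665451's sense (`β(b_c, b_{c′}) = δ_{cc′}`).
[cite: Balaban1985BackgroundPropagators, p.393 (scalar products), bookkeeping] -/
theorem orth_of_repr (hb : ∀ (v : 𝔸) (c : κ), b.repr v c = β (b c) v) (c c' : κ) :
    β (b c) (b c') = if c = c' then 1 else 0 := by
  classical
  rw [← hb, b.repr_self, Finsupp.single_apply]
  by_cases h : c = c'
  · rw [if_pos h, if_pos h.symm]
  · rw [if_neg h, if_neg (fun h' => h h'.symm)]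

omit [DecidableEq κ] in
/-- ★ **PARSEVAL**: for a symmetric `β` and a basis orthonormal for it, `β(v, w) = Σ_c β(b_c, v)·β(b_c, w)`. [cite: Balaban1985BackgroundPropagators, p.393 (scalar products), bookkeeping] -/
theorem pairing_eq_sum_coord (hβ : ∀ v w, β v w = β w v) (hb : ∀ (v : 𝔸) (c : κ), b.repr v c = β (b c) v) (v w : 𝔸) :
    β v w = ∑ c, β (b c) v * β (b c) w := by
  conv_lhs => rw [← b.sum_repr w]
  rw [map_sum]
  refine Finset.sum_congr rfl fun c _ => ?_
  rw [map_smul, smul_eq_mul, hb, hβ v (b c), mul_comm]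

omit [DecidableEq κ] in
/-- ★ **EVERY `Φ : X → 𝔸` IS FRAME-ASSEMBLED OVER THE FULL CARRIER**: `Φ = Σ_{v} β(b_{v.2}, Φ(v.1))·(δ_{v.1} ⊗ b_{v.2})` — p665451's `Φ_w` with `ι = id` and the
coordinates as coefficients. [cite: Balaban1985BackgroundPropagators, p.389 (𝔤-valued lattice functions), bookkeeping] -/
theorem eq_assemble_coord (hb : ∀ (v : 𝔸) (c : κ), b.repr v c = β (b c) v) (Φ : X → 𝔸) :
    Φ = fun x => ∑ v : X × κ, β (b v.2) (Φ v.1) • (Pi.single (id v.1) (b v.2) : X → 𝔸) x := by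
  funext x
  rw [Fintype.sum_prod_type, Finset.sum_eq_single x]
  · simp only [id, Pi.single_eq_same, ← hb]
    exact (b.sum_repr (Φ x)).symm
  · intro y _ hy
    exact Finset.sum_eq_zero fun c _ => by rw [id, Pi.single_eq_of_ne (Ne.symm hy), smul_zero]
  · intro h; exact absurd (Finset.mem_univ _) h

omit [DecidableEq κ] in
/-- ★ **A COORDINATE OF `DΦ` THROUGH THE FULL COORDINATE MATRIX OF `D`**: `β(b_c, (DΦ)(x)) = Σ_v 𝕄(D)((x,c), v)·β(b_{v.2}, Φ(v.1))` (p665451 `mulVec_coordMatrix`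
at `ι = id` on the expansion `eq_assemble_coord`). [cite: Balaban1985BackgroundPropagators, (3.156) p.428; Balaban1984PropagatorsII, (2.51) p.232, dictionary] -/
theorem coord_apply_eq_sum_coordMatrix (hb : ∀ (v : 𝔸) (c : κ), b.repr v c = β (b c) v) (D : (X → 𝔸) →ₗ[ℝ] (X → 𝔸)) (Φ : X → 𝔸)
    (u : X × κ) :
    β (b u.2) (D Φ u.1) =
      ∑ v : X × κ, (Matrix.of fun u v : X × κ => β (b u.2) (D (Pi.single (id v.1) (b v.2)) (id u.1))) u v * β (b v.2) (Φ v.1) := by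
  have h := mulVec_coordMatrix β b (id : X → X) D (fun v : X × κ => β (b v.2) (Φ v.1)) u
  rw [← eq_assemble_coord β b hb Φ] at h
  simp only [Matrix.mulVec, dotProduct] at h
  exact h.symm

omit [DecidableEq κ] in
/-- ★★ **FUNCTORIALITY ON THE FULL CARRIER**: `𝕄(A ∘ B) = 𝕄(A)·𝕄(B)` for the full coordinate matrices in an orthonormal basis (any ℝ-linear `A`, `B` on
`X → 𝔸`) — products of letters read as products of matrices. [cite: Balaban1985BackgroundPropagators, (3.157)–(3.158) p.428 (C*Δ_kC, C C̃ C* as products); Balaban1984PropagatorsII, (2.51) p.232, dictionary] -/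
theorem coordMatrix_comp (hb : ∀ (v : 𝔸) (c : κ), b.repr v c = β (b c) v) (A B : (X → 𝔸) →ₗ[ℝ] (X → 𝔸)) :
    (Matrix.of fun u v : X × κ => β (b u.2) ((A ∘ₗ B) (Pi.single (id v.1) (b v.2)) (id u.1))) =
      (Matrix.of fun u v : X × κ => β (b u.2) (A (Pi.single (id v.1) (b v.2)) (id u.1))) *
        (Matrix.of fun u v : X × κ => β (b u.2) (B (Pi.single (id v.1) (b v.2)) (id u.1))) := by
  ext u w
  rw [Matrix.mul_apply, Matrix.of_apply, LinearMap.comp_apply]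
  rw [show A (B (Pi.single (id w.1) (b w.2))) (id u.1) = A (B (Pi.single (id w.1) (b w.2))) u.1 from rfl,
    coord_apply_eq_sum_coordMatrix β b hb A (B (Pi.single (id w.1) (b w.2))) u]
  exact Finset.sum_congr rfl fun v _ => by simp only [Matrix.of_apply, id]

omit [Fintype X] [Fintype κ] in
/-- `𝕄(id) = 1` in an orthonormal basis. [cite: Balaban1985BackgroundPropagators, p.393, bookkeeping] -/
theorem coordMatrix_id (hb : ∀ (v : 𝔸) (c : κ), b.repr v c = β (b c) v) :
    (Matrix.of fun u v : X × κ => β (b u.2) ((LinearMap.id : (X → 𝔸) →ₗ[ℝ] (X → 𝔸)) (Pi.single (id v.1) (b v.2)) (id u.1))) = 1 := by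
  ext u v
  rw [Matrix.of_apply, LinearMap.id_apply, Matrix.one_apply]
  exact coord_single β b (id : X → X) (orth_of_repr β b hb) (fun _ _ h => h) u v

omit [DecidableEq κ] in
/-- ★★★ **FUNCTORIALITY ALONG A SUB-CARRIER — THE SANDWICH**: for ℝ-linear `C`, `D`, `Ct` on `X → 𝔸` with `Ct` the `β`-adjoint of `C` over the carrier
(`Σ_xβ(Ψx,(CΦ)x) = Σ_xβ((CtΨ)x,Φx)`), a symmetric `β` with an orthonormal basis `b`, and any `ι : σ → X`: the coordinate matrix of `Ct ∘ D ∘ C` along `ι` is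
`Eᵀ·𝕄(D)·E`, `E(v; q) := β(b_{v.2}, (C(δ_{ι q.1} ⊗ b_{q.2}))(v.1))` on `(X × κ) × (σ × κ)`, `𝕄(D)` the full coordinate matrix — print's
«⟨C*g, (C*Δ_kC)⁻¹C*g⟩», «C*Δ_kC has the same exponential decay as Δ_k» read as matrix algebra. [cite: Balaban1985BackgroundPropagators, (3.157) p.428; Balaban1984PropagatorsII, p.250, dictionary] -/
theorem coordMatrix_sandwich {σ : Type*} [Fintype σ] (hβ : ∀ v w, β v w = β w v) (hb : ∀ (v : 𝔸) (c : κ), b.repr v c = β (b c) v)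
    (C D Ct : (X → 𝔸) →ₗ[ℝ] (X → 𝔸)) (hadj : ∀ Φ Ψ : X → 𝔸, ∑ x, β (Ψ x) (C Φ x) = ∑ x, β (Ct Ψ x) (Φ x)) (ι : σ → X) :
    (Matrix.of fun p q : σ × κ => β (b p.2) ((Ct ∘ₗ D ∘ₗ C) (Pi.single (ι q.1) (b q.2)) (ι p.1))) =
      (Matrix.of fun (v : X × κ) (q : σ × κ) => β (b v.2) (C (Pi.single (ι q.1) (b q.2)) v.1))ᵀ *
        (Matrix.of fun u v : X × κ => β (b u.2) (D (Pi.single (id v.1) (b v.2)) (id u.1))) *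
        (Matrix.of fun (v : X × κ) (q : σ × κ) => β (b v.2) (C (Pi.single (ι q.1) (b q.2)) v.1)) := by
  ext p q
  simp only [Matrix.mul_apply, Matrix.transpose_apply, Matrix.of_apply, LinearMap.comp_apply]
  -- move `Ct` across the pairing: β(b_{p.2}, (Ct W)(ι p.1)) = Σ_x β(W x, (C e_p) x) with W := D (C e_q)
  have h1 : β (b p.2) (Ct (D (C (Pi.single (ι q.1) (b q.2)))) (ι p.1)) =
      ∑ x, β (D (C (Pi.single (ι q.1) (b q.2))) x) (C (Pi.single (ι p.1) (b p.2)) x) := by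
    rw [← sum_pairing_single β (ι p.1) (b p.2) (Ct (D (C (Pi.single (ι q.1) (b q.2)))))]
    rw [show (∑ x, β ((Pi.single (ι p.1) (b p.2) : X → 𝔸) x) (Ct (D (C (Pi.single (ι q.1) (b q.2)))) x)) =
        ∑ x, β (Ct (D (C (Pi.single (ι q.1) (b q.2)))) x) ((Pi.single (ι p.1) (b p.2) : X → 𝔸) x) from
      Finset.sum_congr rfl fun x _ => hβ _ _]
    exact (hadj _ _).symm
  rw [h1]
  -- Parseval at each point, then the coordinates of `D(C e_q)` through `𝕄(D)`
  have h2 : ∀ x, β (D (C (Pi.single (ι q.1) (b q.2))) x) (C (Pi.single (ι p.1) (b p.2)) x) =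
      ∑ c, β (b c) (D (C (Pi.single (ι q.1) (b q.2))) x) * β (b c) (C (Pi.single (ι p.1) (b p.2)) x) :=
    fun x => pairing_eq_sum_coord β b hβ hb _ _
  simp only [h2]
  rw [← Fintype.sum_prod_type' (f := fun x c =>
    β (b c) (D (C (Pi.single (ι q.1) (b q.2))) x) * β (b c) (C (Pi.single (ι p.1) (b p.2)) x))]
  rw [Finset.sum_congr rfl fun u _ => by rw [coord_apply_eq_sum_coordMatrix β b hb D (C (Pi.single (ι q.1) (b q.2))) u]]
  -- LHS `Σ_u (Σ_v 𝕄(D) u v · c_q v) · E u p`, RHS `Σ_v (Σ_u E u p · 𝕄(D) u v) · c_q v`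
  simp only [Finset.sum_mul]
  rw [Finset.sum_comm]
  refine Finset.sum_congr rfl fun v _ => Finset.sum_congr rfl fun u _ => ?_
  simp only [Matrix.of_apply]
  ring

omit [Fintype X] [Fintype κ] in
/-- the full coordinate matrix of a difference, in the precision door's shape `P − 0·1 − 𝒥`. [cite: Balaban1985BackgroundPropagators, (3.156) p.428, bookkeeping] -/
theorem coordMatrix_sub (P J : (X → 𝔸) →ₗ[ℝ] (X → 𝔸)) :
    (Matrix.of fun u v : X × κ => β (b u.2) ((P - J) (Pi.single (id v.1) (b v.2)) (id u.1))) =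
      (Matrix.of fun u v : X × κ => β (b u.2) (P (Pi.single (id v.1) (b v.2)) (id u.1))) - (0 : ℝ) • (1 : Matrix (X × κ) (X × κ) ℝ) -
        (Matrix.of fun u v : X × κ => β (b u.2) (J (Pi.single (id v.1) (b v.2)) (id u.1))) := by
  ext u v
  simp only [zero_smul, sub_zero, Matrix.sub_apply, Matrix.of_apply, LinearMap.sub_apply, Pi.sub_apply, map_sub]

end Basis

/-! ## §2  At def-Y's letters: `C*Δ_kC` as a composite; its coordinate matrix as the sandwich; the `E`-rows from operator currency -/

section Letters

variable {d ℓ : ℕ} {hd : 1 ≤ d + 1} {hL : Odd (ℓ + 1) ∧ 1 < ℓ + 1} {w₀ w₁ : ℝ} {Mstar : ℕ}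
variable {𝔸 : Type} [NormedRing 𝔸] [NormedAlgebra ℂ 𝔸] [CompleteSpace 𝔸]
variable {x : MemberY d ℓ hd hL w₀ w₁ Mstar} [DecidableEq (IBondY x.toKIdx)] {𝔏 : CovLettersY 𝔸 x} {𝔢 : SectELettersY 𝔸 x}
variable {κ : Type} [Fintype κ] [DecidableEq κ] {σ : Type} [Fintype σ]

omit [DecidableEq (IBondY x.toKIdx)] in
/-- (3.157) as a composite of ℝ-linear maps: `C*Δ_kC = C* ∘ (QG₁Q*)⁻¹ − (a + ⟨D̃⁽²⁾·,J⟩) ∘ C` with def-Y's `CsDeltaCY = elimCtΛY · deltaKY · elimCΛY`,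
`deltaKY = QG1Qinv − aY − D2J`. [cite: Balaban1985BackgroundPropagators, (3.156)–(3.157) p.428, bookkeeping] -/
theorem restrictScalars_CsDeltaCY_eq_comp (U : CfgY 𝔸 x.toKIdx) :
    (CsDeltaCY x 𝔏 𝔢 U).restrictScalars ℝ =
      (elimCtΛY x 𝔢 U).restrictScalars ℝ ∘ₗ ((𝔏.QG1Qinv U).restrictScalars ℝ - (aY x.toKIdx + 𝔢.D2J U).restrictScalars ℝ) ∘ₗ
        (elimCΛY x 𝔢 U).restrictScalars ℝ := by
  apply LinearMap.ext
  intro Φ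
  simp only [LinearMap.restrictScalars_apply, LinearMap.comp_apply, LinearMap.sub_apply, CsDeltaCY, Module.End.mul_apply, deltaKY_apply,
    LinearMap.add_apply, sub_sub]

/-- ★★ **`𝕄_ι(C*Δ_kC) = Eᵀ·(P − 0·1 − 𝒥)·E` AT THE LETTERS** — the coordinate matrix of def-Y's `CsDeltaCY x 𝔏 𝔢 U` along `ι : σ → IBondY` in an orthonormal
basis `b` IS the precision door's structured matrix with `P := 𝕄((QG₁Q*)⁻¹(U))`, `𝒥 := 𝕄(a + ⟨D̃⁽²⁾·,J⟩(U))` (full index-bond × basis coordinates) and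
`E := 𝕄(P_Λ C P_Λ̃)` (columns along `ι`), GIVEN the β-adjointness of `elimCΛY ∕ elimCtΛY` over the carrier ((R3′); at `M_N(ℂ)` def-Y's `sum_tr_elimCY_mul`).
[cite: Balaban1985BackgroundPropagators, (3.156)–(3.157) p.428; Balaban1984PropagatorsII, p.250, dictionary] -/
theorem coordMatrix_CsDeltaCY_eq_sandwich (U : CfgY 𝔸 x.toKIdx) (β : 𝔸 →ₗ[ℝ] 𝔸 →ₗ[ℝ] ℝ) (hβ : ∀ v w, β v w = β w v)
    (b : Module.Basis κ ℝ 𝔸) (hb : ∀ (v : 𝔸) (c : κ), b.repr v c = β (b c) v) (ι : σ → IBondY x.toKIdx)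
    (hadj : ∀ Φ Ψ : IBondY x.toKIdx → 𝔸, ∑ u, β (Ψ u) (((elimCΛY x 𝔢 U).restrictScalars ℝ) Φ u) =
      ∑ u, β (((elimCtΛY x 𝔢 U).restrictScalars ℝ) Ψ u) (Φ u)) :
    (Matrix.of fun p q : σ × κ => β (b p.2) (((CsDeltaCY x 𝔏 𝔢 U).restrictScalars ℝ) (Pi.single (ι q.1) (b q.2)) (ι p.1))) =
      (Matrix.of fun (v : IBondY x.toKIdx × κ) (q : σ × κ) =>
          β (b v.2) (((elimCΛY x 𝔢 U).restrictScalars ℝ) (Pi.single (ι q.1) (b q.2)) v.1))ᵀ *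
        ((Matrix.of fun u v : IBondY x.toKIdx × κ => β (b u.2) (((𝔏.QG1Qinv U).restrictScalars ℝ) (Pi.single (id v.1) (b v.2)) (id u.1))) -
          (0 : ℝ) • (1 : Matrix (IBondY x.toKIdx × κ) (IBondY x.toKIdx × κ) ℝ) -
          (Matrix.of fun u v : IBondY x.toKIdx × κ => β (b u.2) (((aY x.toKIdx + 𝔢.D2J U).restrictScalars ℝ) (Pi.single (id v.1) (b v.2)) (id u.1)))) *
        (Matrix.of fun (v : IBondY x.toKIdx × κ) (q : σ × κ) =>
          β (b v.2) (((elimCΛY x 𝔢 U).restrictScalars ℝ) (Pi.single (ι q.1) (b q.2)) v.1)) := by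
  rw [← coordMatrix_sub β b, restrictScalars_CsDeltaCY_eq_comp U]
  exact coordMatrix_sandwich β b hβ hb _ _ _ hadj ι

omit [Fintype κ] [DecidableEq κ] [Fintype σ] in
/-- the door's LOCALITY row of `E` from operator currency: if `(C(δ_{ι s} ⊗ w))(u) ≠ 0` forces `|y_u − y_{ι s}| ≤ r`, then `E(u; q) ≠ 0` forces the same.
[cite: Balaban1985BackgroundPropagators, (3.157) p.428 («an identity operator on almost all bonds, except the bonds b₀»), bookkeeping] -/
theorem locality_coord_of_op (U : CfgY 𝔸 x.toKIdx) (β : 𝔸 →ₗ[ℝ] 𝔸 →ₗ[ℝ] ℝ) (b : Module.Basis κ ℝ 𝔸) (ι : σ → IBondY x.toKIdx) {r : ℝ}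
    (hloc : ∀ (s : σ) (w : 𝔸) (u : IBondY x.toKIdx), elimCΛY x 𝔢 U (Pi.single (ι s) w) u ≠ 0 → unitDistY x u (ι s) ≤ r)
    (u : IBondY x.toKIdx × κ) (q : σ × κ)
    (h : (Matrix.of fun (v : IBondY x.toKIdx × κ) (q : σ × κ) =>
      β (b v.2) (((elimCΛY x 𝔢 U).restrictScalars ℝ) (Pi.single (ι q.1) (b q.2)) v.1)) u q ≠ 0) :
    unitDistY x u.1 (ι q.1) ≤ r := by
  refine hloc q.1 (b q.2) u.1 fun h0 => h ?_
  rw [Matrix.of_apply, LinearMap.restrictScalars_apply, h0, map_zero]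

omit [DecidableEq κ] [Fintype σ] in
/-- the door's COLUMN-MASS row of `E` from operator currency: `Σ_u ‖(C(δ_{ι s} ⊗ b_c))(u)‖ ≤ m` and `|β(b_c, v)| ≤ c_β‖v‖` give `Σ_{(u,c′)} |E((u,c′); (s,c))| ≤
|κ|·c_β·m`. [cite: Balaban1985BackgroundPropagators, (3.157) p.428, bookkeeping] -/
theorem colMass_coord_of_op (U : CfgY 𝔸 x.toKIdx) (β : 𝔸 →ₗ[ℝ] 𝔸 →ₗ[ℝ] ℝ) (b : Module.Basis κ ℝ 𝔸) (ι : σ → IBondY x.toKIdx) {cβ m : ℝ}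
    (hcβ : 0 ≤ cβ) (hβn : ∀ (c : κ) (v : 𝔸), |β (b c) v| ≤ cβ * ‖v‖)
    (hmass : ∀ (s : σ) (c : κ), ∑ u, ‖elimCΛY x 𝔢 U (Pi.single (ι s) (b c)) u‖ ≤ m) (q : σ × κ) :
    ∑ u : IBondY x.toKIdx × κ, |(Matrix.of fun (v : IBondY x.toKIdx × κ) (q : σ × κ) =>
      β (b v.2) (((elimCΛY x 𝔢 U).restrictScalars ℝ) (Pi.single (ι q.1) (b q.2)) v.1)) u q| ≤ Fintype.card κ * cβ * m := by
  simp only [Matrix.of_apply, LinearMap.restrictScalars_apply]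
  rw [Fintype.sum_prod_type]
  calc ∑ u, ∑ c, |β (b c) (elimCΛY x 𝔢 U (Pi.single (ι q.1) (b q.2)) u)|
      ≤ ∑ u, ∑ _c : κ, cβ * ‖elimCΛY x 𝔢 U (Pi.single (ι q.1) (b q.2)) u‖ :=
        Finset.sum_le_sum fun u _ => Finset.sum_le_sum fun c _ => hβn _ _
    _ = Fintype.card κ * cβ * ∑ u, ‖elimCΛY x 𝔢 U (Pi.single (ι q.1) (b q.2)) u‖ := by
        simp only [Finset.sum_const, Finset.card_univ, nsmul_eq_mul, Finset.mul_sum]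
        exact Finset.sum_congr rfl fun u _ => by ring
    _ ≤ Fintype.card κ * cβ * m := mul_le_mul_of_nonneg_left (hmass q.1 q.2) (by positivity)

end Letters

/-! ## §3  [Balaban1982Higgs1] (3.24) for `dμ_{C̃^{(k)}(Λ; U)}` at the letters, PRECISION currency -/

section Door

variable {d : ℕ}

/-- ★★★ **(3.24) FOR `dμ_{C̃^{(k)}(Λ; U)}` AT NODE 00's NAMED LETTERS, PRECISION CURRENCY, EVERY `η ∈ (0,1]`** — print's own route (p. 428, [PropII] p. 250).
A basis index `κ ≠ ∅` of the fibre, class scalars `γ₀ > 0`, `B_P, K_J ≥ 0`, rate `δ > 0`, locality radius `r`, column mass `m ≥ 0`, frame constants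
`c_β, n_e ≥ 0`, the (3.24) letters FIRST ⇒ `∃ b₁ ∀ b₀ > b₁ ∃ C ≥ 0` such that for EVERY `η ∈ (0,1]`, member `x`, letters `𝔏 𝔢`, background `U` (fibre `𝔸` a
complete normed `ℂ`-algebra, finite-dimensional over ℝ), symmetric pairing `β` with an orthonormal BASIS `b` (`repr_c v = β(b_c,v)`, `|β(b_c,v)| ≤ c_β‖v‖`,
`‖b_c‖ ≤ n_e`), injective `ι : σ → Λ̃` (`σ ≠ ∅`), GIVEN AT THE LETTERS: (R1′) `(QG₁Q*)⁻¹(U)` and `a + ⟨D̃⁽²⁾·,J⟩(U)` β-self-adjoint over the carrier; (R2′)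
`sup_{‖E‖≤1}‖((QG₁Q*)⁻¹(U)(δ_{v} ⊗ E))(u)‖ ≤ B_Pe^{−δ|y_u−y_v|}` on ALL index bonds (node N06's (3.132) row in `siteKernelOfOp` shape) and
`‖((a + ⟨D̃⁽²⁾·,J⟩(U))(δ_v ⊗ E))(u)‖ ≤ K_J‖E‖e^{−δ|y_u−y_v|}`; (R3′) `P_Λ C P_Λ̃` and `P_Λ̃ C* P_Λ` β-adjoint over the carrier; (R4′) locality and column mass
of `P_Λ C P_Λ̃` along `ι`; (R5′) `γ₀·Σβ(Φ,Φ) ≤ Σβ(Φ,(C*Δ_kC)Φ)` for `ι(σ)`-supported `Φ`: a window `Λ_w ⊂ ℤ^{2(d+1)+1}`, `e′ : σ × κ ≃ ↥Λ_w` presenting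
`𝒩(0, 𝕄_ι(C*Δ_kC)⁻¹)`, the a.e. box identity and the (3.24) pair for every `(s, I ⊇ J, 𝔞)` with `I ≠ ∅`, `J ⊆ Λ_w`, `sup|𝔞| ≤ c·η^σ`.  Proof: §1–§2 and p665451
into p664951 `eq324_sectEPrecision_node00_on_unit` at `(γ₀, c_βn_eB_P, c_βn_eK_J, a₀ := 0, δ, r, |κ|c_βm)`, then `𝕄_ι(C*Δ_kC) = Eᵀ(P − 0·1 − 𝒥)E`.
[cite: Balaban1985BackgroundPropagators, (3.132) p.422, (3.155)–(3.158) pp.427–428, Thm 3.11 p.416; Balaban1984PropagatorsII, p.250; Balaban1985UV3, (24) p.262,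
(58) p.270, pp.271–272; Balaban1982Higgs1, (3.24) p.616; BenfattoEtAl1978, Lemma (4.5)–(4.7) p.152 (class form; bent window, presentation and coordinates ours)] -/
theorem eq324_CsDeltaCY_precision_node00_on_unit (κ : Type) [Fintype κ] [DecidableEq κ] [Nonempty κ] {γ₀ BP KJ δ r m cβ ne : ℝ}
    (hγ₀ : 0 < γ₀) (hBP : 0 ≤ BP) (hKJ : 0 ≤ KJ) (hδ : 0 < δ) (hm : 0 ≤ m) (hcβ : 0 ≤ cβ) (hne : 0 ≤ ne) (t D : ℕ) {ϰ : ℝ} (hϰ : 0 < ϰ)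
    {p₀ σ' c κ' : ℝ} (hp₀ : 2 / 3 < p₀) (hσ : 0 < σ') (hc : 0 ≤ c) (hκ : 0 < κ') (hκσ : κ' < σ' * (t + 1)) :
    ∃ b₁ : ℝ, ∀ b₀ : ℝ, b₁ < b₀ → ∃ C : ℝ, 0 ≤ C ∧ ∀ η : ℝ, 0 < η → η ≤ 1 →
      ∀ {ℓ : ℕ} {hd : 1 ≤ d + 1} {hL : Odd (ℓ + 1) ∧ 1 < ℓ + 1} {w₀ w₁ : ℝ} {Mstar : ℕ} (x : MemberY d ℓ hd hL w₀ w₁ Mstar)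
        [DecidableEq (IBondY x.toKIdx)] {𝔸 : Type} [NormedRing 𝔸] [NormedAlgebra ℂ 𝔸] [CompleteSpace 𝔸] [FiniteDimensional ℝ 𝔸]
        (𝔏 : CovLettersY 𝔸 x) (𝔢 : SectELettersY 𝔸 x) (U : CfgY 𝔸 x.toKIdx)
        (β : 𝔸 →ₗ[ℝ] 𝔸 →ₗ[ℝ] ℝ), (∀ v w, β v w = β w v) →
      ∀ (b : Module.Basis κ ℝ 𝔸), (∀ (v : 𝔸) (c' : κ), b.repr v c' = β (b c') v) → (∀ (c' : κ) (v : 𝔸), |β (b c') v| ≤ cβ * ‖v‖) →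
        (∀ c', ‖b c'‖ ≤ ne) →
      ∀ {σ : Type} [Fintype σ] [DecidableEq σ] [Nonempty σ] (ι : σ → IBondY x.toKIdx), Function.Injective ι → (∀ s, 𝔢.LamT (ι s)) →
        (∀ Φ Ψ : IBondY x.toKIdx → 𝔸, ∑ u, β (Ψ u) (((𝔏.QG1Qinv U).restrictScalars ℝ) Φ u) =
          ∑ u, β (((𝔏.QG1Qinv U).restrictScalars ℝ) Ψ u) (Φ u)) →
        (∀ Φ Ψ : IBondY x.toKIdx → 𝔸, ∑ u, β (Ψ u) (((aY x.toKIdx + 𝔢.D2J U).restrictScalars ℝ) Φ u) =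
          ∑ u, β (((aY x.toKIdx + 𝔢.D2J U).restrictScalars ℝ) Ψ u) (Φ u)) →
        (∀ u v : IBondY x.toKIdx,
          (⨆ E : BallY 𝔸, ‖𝔏.QG1Qinv U (deltaY v (E : 𝔸)) u‖) ≤ BP * Real.exp (-(δ * unitDistY x u v))) →
        (∀ (u v : IBondY x.toKIdx) (E : 𝔸),
          ‖((aY x.toKIdx + 𝔢.D2J U).restrictScalars ℝ) (Pi.single v E) u‖ ≤ KJ * ‖E‖ * Real.exp (-(δ * unitDistY x u v))) →
        (∀ Φ Ψ : IBondY x.toKIdx → 𝔸, ∑ u, β (Ψ u) (((elimCΛY x 𝔢 U).restrictScalars ℝ) Φ u) =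
          ∑ u, β (((elimCtΛY x 𝔢 U).restrictScalars ℝ) Ψ u) (Φ u)) →
        (∀ (s : σ) (w : 𝔸) (u : IBondY x.toKIdx), elimCΛY x 𝔢 U (Pi.single (ι s) w) u ≠ 0 → unitDistY x u (ι s) ≤ r) →
        (∀ (s : σ) (c' : κ), ∑ u, ‖elimCΛY x 𝔢 U (Pi.single (ι s) (b c')) u‖ ≤ m) →
        (∀ Φ : IBondY x.toKIdx → 𝔸, (∀ u, u ∉ Set.range ι → Φ u = 0) → (∀ u, Φ u ∈ Submodule.span ℝ (Set.range b)) →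
          γ₀ * ∑ u, β (Φ u) (Φ u) ≤ ∑ u, β (Φ u) (((CsDeltaCY x 𝔏 𝔢 U).restrictScalars ℝ) Φ u)) →
      ∃ (Λ : Finset (B1Eq324BenfattoLemma.Site (d + 1 + (d + 1) + 1))) (e' : σ × κ ≃ ↥Λ),
        ((gaussianFieldOfKernel fun u w => if h : u ∈ Λ ∧ w ∈ Λ then
            ((Matrix.reindex e' e'
              (Matrix.of fun p q : σ × κ =>
                  β (b p.2) (((CsDeltaCY x 𝔏 𝔢 U).restrictScalars ℝ) (Pi.single (ι q.1) (b q.2)) (ι p.1))))⁻¹ :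
                Matrix ↥Λ ↥Λ ℝ) ⟨u, h.1⟩ ⟨w, h.2⟩ else 0).map
            (fun (z : B1Eq324BenfattoLemma.Site (d + 1 + (d + 1) + 1) → ℝ) (q : σ × κ) =>
              z ((e' q : ↥Λ) : B1Eq324BenfattoLemma.Site (d + 1 + (d + 1) + 1))) =
          gaussianFieldOfKernel fun p q =>
            ((Matrix.of fun p q : σ × κ =>
                β (b p.2) (((CsDeltaCY x 𝔏 𝔢 U).restrictScalars ℝ) (Pi.single (ι q.1) (b q.2)) (ι p.1)))⁻¹ :
              Matrix (σ × κ) (σ × κ) ℝ) p q) ∧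
        (∀ p : ℝ, 0 ≤ p →
          ((fun (z : B1Eq324BenfattoLemma.Site (d + 1 + (d + 1) + 1) → ℝ) (q : σ × κ) =>
              z ((e' q : ↥Λ) : B1Eq324BenfattoLemma.Site (d + 1 + (d + 1) + 1))) ⁻¹'
              {ω : σ × κ → ℝ | ∀ q, |ω q| ≤ p}) =ᵐ[gaussianFieldOfKernel fun u w => if h : u ∈ Λ ∧ w ∈ Λ then
                ((Matrix.reindex e' e'
                  (Matrix.of fun p q : σ × κ =>
                      β (b p.2) (((CsDeltaCY x 𝔏 𝔢 U).restrictScalars ℝ) (Pi.single (ι q.1) (b q.2)) (ι p.1))))⁻¹ :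
                    Matrix ↥Λ ↥Λ ℝ) ⟨u, h.1⟩ ⟨w, h.2⟩ else 0]
            smallFieldSet Λ p) ∧
        ∀ (s : ℕ) (I J : Finset (B1Eq324BenfattoLemma.Site (d + 1 + (d + 1) + 1))) (𝔞 : Coef (d + 1 + (d + 1) + 1)),
          I.Nonempty → J ⊆ I → J ⊆ Λ → coefSup s D 𝔞 J ≤ c * η ^ σ' →
          0 < ∫ z, cutoffBoltzmann (hamiltonian s D ϰ 𝔞 J) I (B10.pFun b₀ p₀ η) z ∂(gaussianFieldOfKernel fun u w => if h : u ∈ Λ ∧ w ∈ Λ then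
              ((Matrix.reindex e' e'
                (Matrix.of fun p q : σ × κ =>
                    β (b p.2) (((CsDeltaCY x 𝔏 𝔢 U).restrictScalars ℝ) (Pi.single (ι q.1) (b q.2)) (ι p.1))))⁻¹ :
                  Matrix ↥Λ ↥Λ ℝ) ⟨u, h.1⟩ ⟨w, h.2⟩ else 0) ∧
            |Real.log (∫ z, cutoffBoltzmann (hamiltonian s D ϰ 𝔞 J) I (B10.pFun b₀ p₀ η) z ∂(gaussianFieldOfKernel fun u w =>
                if h : u ∈ Λ ∧ w ∈ Λ then
                  ((Matrix.reindex e' e'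
                    (Matrix.of fun p q : σ × κ =>
                        β (b p.2) (((CsDeltaCY x 𝔏 𝔢 U).restrictScalars ℝ) (Pi.single (ι q.1) (b q.2)) (ι p.1))))⁻¹ :
                      Matrix ↥Λ ↥Λ ℝ) ⟨u, h.1⟩ ⟨w, h.2⟩ else 0)) -
              cumulantSum (gaussianFieldOfKernel fun u w => if h : u ∈ Λ ∧ w ∈ Λ then
                  ((Matrix.reindex e' e'
                    (Matrix.of fun p q : σ × κ =>
                        β (b p.2) (((CsDeltaCY x 𝔏 𝔢 U).restrictScalars ℝ) (Pi.single (ι q.1) (b q.2)) (ι p.1))))⁻¹ :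
                      Matrix ↥Λ ↥Λ ℝ) ⟨u, h.1⟩ ⟨w, h.2⟩ else 0)
                (hamiltonian s D ϰ 𝔞 J) t| ≤ C * η ^ κ' * I.card := by
  have hKP : 0 ≤ cβ * ne * BP := by positivity
  have hKJ' : 0 ≤ cβ * ne * KJ := by positivity
  have hmC : 0 ≤ Fintype.card κ * cβ * m := by positivity
  obtain ⟨b₁, hb₁⟩ := eq324_sectEPrecision_node00_on_unit (d := d) κ hγ₀ hKP hKJ' le_rfl hδ hmC t D hϰ hp₀ hσ hc hκ hκσ (r := r)
  refine ⟨b₁, fun b₀ hb₀ => ?_⟩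
  obtain ⟨C, hC, hE⟩ := hb₁ b₀ hb₀
  refine ⟨C, hC, ?_⟩
  intro η hη hηle ℓ hd hL w₀ w₁ Mstar x _ 𝔸 _ _ _ _ 𝔏 𝔢 U β hβ b hb hβn hen σ _ _ _ ι hι hιT hPadj hJadj hProw hJker hCadj hloc hmass hco
  have htop : ∀ s, lvl x.hN x.D x.hk (ι s) = x.k := fun s => inΛY_top (𝔢.LamT_inΛ _ (hιT s))
  have he : ∀ c₁ c₂ : κ, β (b c₁) (b c₂) = if c₁ = c₂ then 1 else 0 := orth_of_repr β b hb
  -- the rows of `P := 𝕄(Pop)` and `𝒥 := 𝕄(Jop)` on the full carrier (p665451 at `ι = id`)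
  have hPs := coordMatrix_symm_of_selfAdjoint β b (id : IBondY x.toKIdx → IBondY x.toKIdx) ((𝔏.QG1Qinv U).restrictScalars ℝ) hβ hPadj
  have hJs := coordMatrix_symm_of_selfAdjoint β b (id : IBondY x.toKIdx → IBondY x.toKIdx) ((aY x.toKIdx + 𝔢.D2J U).restrictScalars ℝ)
    hβ hJadj
  have hPker : ∀ (u v : IBondY x.toKIdx) (E : 𝔸),
      ‖((𝔏.QG1Qinv U).restrictScalars ℝ) (Pi.single (id v) E) (id u)‖ ≤ BP * ‖E‖ * Real.exp (-(δ * unitDistY x u v)) := by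
    intro u v E
    have hsup : (⨆ E' : ↥(Metric.closedBall (0 : 𝔸) 1), ‖((𝔏.QG1Qinv U).restrictScalars ℝ) (Pi.single v (E' : 𝔸)) u‖) ≤
        BP * Real.exp (-(δ * unitDistY x u v)) := by
      have h := hProw u v
      have hfun : (fun E' : BallY 𝔸 => ‖𝔏.QG1Qinv U (deltaY v (E' : 𝔸)) u‖) =
          fun E' : ↥(Metric.closedBall (0 : 𝔸) 1) => ‖((𝔏.QG1Qinv U).restrictScalars ℝ) (Pi.single v (E' : 𝔸)) u‖ := by
        funext E'; rw [deltaY_eq_single, LinearMap.restrictScalars_apply]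
      rw [hfun] at h
      exact h
    have h := kernelReading_homog_of_ball ((𝔏.QG1Qinv U).restrictScalars ℝ)
      (norm_le_of_iSup_closedBall_le ((𝔏.QG1Qinv U).restrictScalars ℝ) u v hsup) E
    calc ‖((𝔏.QG1Qinv U).restrictScalars ℝ) (Pi.single (id v) E) (id u)‖ = ‖((𝔏.QG1Qinv U).restrictScalars ℝ) (Pi.single v E) u‖ := rfl
      _ ≤ BP * Real.exp (-(δ * unitDistY x u v)) * ‖E‖ := h
      _ = BP * ‖E‖ * Real.exp (-(δ * unitDistY x u v)) := by ring
  have hJker' : ∀ (u v : IBondY x.toKIdx) (E : 𝔸),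
      ‖((aY x.toKIdx + 𝔢.D2J U).restrictScalars ℝ) (Pi.single (id v) E) (id u)‖ ≤ KJ * ‖E‖ * Real.exp (-(δ * unitDistY x u v)) :=
    fun u v E => hJker u v E
  have hP := abs_coordMatrix_le β b (id : IBondY x.toKIdx → IBondY x.toKIdx) ((𝔏.QG1Qinv U).restrictScalars ℝ) hcβ hBP (unitDistY x)
    hβn hen hPker
  have hJ := abs_coordMatrix_le β b (id : IBondY x.toKIdx → IBondY x.toKIdx) ((aY x.toKIdx + 𝔢.D2J U).restrictScalars ℝ) hcβ hKJ
    (unitDistY x) hβn hen hJker'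
  -- the rows of `E`
  have hCr := locality_coord_of_op (𝔢 := 𝔢) U β b ι hloc
  have hC1 := colMass_coord_of_op (𝔢 := 𝔢) U β b ι hcβ hβn hmass
  -- the γ₀ row of `T := 𝕄_ι(A)`, rewritten as the sandwich
  have hγ := coercive_coordMatrix β b ι ((CsDeltaCY x 𝔏 𝔢 U).restrictScalars ℝ) he hι hco
  have hsand := coordMatrix_CsDeltaCY_eq_sandwich (𝔏 := 𝔏) (𝔢 := 𝔢) U β hβ b hb ι hCadj
  rw [hsand] at hγ
  have h := hE η hη hηle x ι hι htop (a := (0 : ℝ)) hPs hJs hP hJ (by rw [abs_zero]) (fun u q huq => hCr u q huq) hC1 hγ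
  rw [← hsand] at h
  exact h

/-- Non-vacuity of the scalar side of `eq324_CsDeltaCY_precision_node00_on_unit`: `d + 1 = 4`, a `24`-element basis index, `γ₀ = 1`, `B_P = K_J = 1`, `δ = 1`,
`r = 2`, `m = 9`, `c_β = n_e = 1`, and the socket letters `t = 6`, `D = 4`, `ϰ = 1`, `p₀ = 1`, `σ = 1/2`, `c = 1`, `κ = 13/4`.
[cite: Balaban1985UV3, (24) p.262 (letters of the socket; instance ours)] -/
example :=
  eq324_CsDeltaCY_precision_node00_on_unit (d := 3) (Fin 24) (γ₀ := 1) (BP := 1) (KJ := 1) (δ := 1) (r := 2) (m := 9) (cβ := 1) (ne := 1)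
    one_pos zero_le_one zero_le_one one_pos (by norm_num) zero_le_one zero_le_one 6 4 (ϰ := 1) one_pos (p₀ := 1) (σ' := 1 / 2) (c := 1)
    (κ' := 13 / 4) (by norm_num) (by norm_num) zero_le_one (by norm_num) (by norm_num)

end Door

end Literature.MathematicalPhysics.QuantumFieldTheory.Balaban1983to89.B1Eq324BenfattoClassSectEMemberCoReadProduct
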